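import Summits.FinalStateConjecture.FinalStateConjecture.Theorems.EIHFluxBalanceInertialRecessionPerforatedGauss

/-!
# Route EIHFluxBalance — `InertialRecession`, line `sublinear-is-free-clean-window-charges`:
# the cutoff (bulk) form of the Landau–Lifshitz charge and the vanishing of the spatial components
# of the cutoff current of a STATIC vacuum field (stub `stub_identification`, part A1b)

Helper file (`--supports stmt-FinalStateConjecture-10166`) for the crux
`Summit.FinalStateConjecture.FinalStateConjecture.Theses.EIHFluxBalance.InertialRecession`.

Two Euclidean identities behind the Lorentz covariance of the Landau–Lifshitz four-momentum of a
boosted Kerr–Schild hole (LL §96: `P^i` is a four-vector), in the distributional form that needs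
no Stokes theorem on tilted hypersurfaces:
* `quasiLocalMomentum_eq_integral_cutoff` — if `Σ_α ∂_α h^{μ0α} = 0` off a set `K` of the slice
  `{x⁰ = t}` and `χ` is a smooth cutoff, `χ = 0` near `K`, `χ = 1` near and beyond the sphere
  `{|y − ξ| = R}`, then `P^μ(t; ξ, R) = ∫ Σ_j ∂_jχ · h^{μ0j}(t, ·)` (Gauss–Green on the ball for the
  global `C¹` field `χ h^{μ0·}`; the charge is the pairing of the divergence-free field with `∇χ`);
* `integral_cutoff_spatial_eq_zero` — if moreover `Σ_α ∂_α h^{μnα} = 0` and `∂_0 h^{μn0} = 0`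
  (stationarity) off `K`, then `∫ Σ_m ∂_mχ · h^{μ n m}(t, ·) = 0` for every SPATIAL `n`: the
  integrand is the `n`-th component of the compactly supported divergence-free field
  `J^n = Σ_m h^{μnm} ∂_mχ` (antisymmetry of `h` in its last two indices, LL (96.4), against the
  symmetric Hessian of `χ`), and `J^n = div (y_n J)` integrates to zero.
[cite: LandauLifshitz1975, §96 (96.4), (96.16)]
-/

set_option linter.dupNamespace false

noncomputable section

-- instance search on the nested operator spaces `E4 →L[ℝ] E4 →L[ℝ] ℝ` is deep
set_option maxSynthPendingDepth 3

open Set Metric Filter MeasureTheory MeasureTheory.Measure Module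
open scoped Topology ContDiff RealInnerProductSpace

namespace Summit.FinalStateConjecture.FinalStateConjecture.Theorems

namespace SublinearIsFree.ChargeModel

open Literature.Geometry.Lorentzian Literature.Geometry.Lorentzian.LandauLifshitz
open Literature.Analysis.FluidPDE LLBalance LLGauss SublinearIsFree.WindowCharges

variable {g : E4 → E4 →L[ℝ] E4 →L[ℝ] ℝ} {W : Set E4}

/-! ### Generic calculus of plateau cutoffs on `E3` -/

/-- A function which is `C^n` off `K` and vanishes near every point of `K` is `C^n`. [folklore] -/
theorem contDiff_of_eventuallyEq_zero {V : Type*} [NormedAddCommGroup V] [NormedSpace ℝ V]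
    {n : WithTop ℕ∞} {F : E3 → V} {K : Set E3} (hF : ∀ y ∉ K, ContDiffAt ℝ n F y)
    (h0 : ∀ y ∈ K, F =ᶠ[𝓝 y] fun _ ↦ 0) : ContDiff ℝ n F := by
  refine contDiff_iff_contDiffAt.2 fun y ↦ ?_
  by_cases hy : y ∈ K
  · exact contDiffAt_const.congr_of_eventuallyEq (h0 y hy)
  · exact hF y hy

/-- Near a point where `χ` is locally constant, its directional derivatives vanish identically.
[folklore] -/
theorem fderiv_apply_eventuallyEq_zero {χ : E3 → ℝ} {y : E3} {c : ℝ} (h : χ =ᶠ[𝓝 y] fun _ ↦ c)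
    (v : E3) : (fun z ↦ fderiv ℝ χ z v) =ᶠ[𝓝 y] fun _ ↦ 0 := by
  filter_upwards [h.eventually_nhds] with z hz
  rw [Filter.EventuallyEq.fderiv_eq (hz : χ =ᶠ[𝓝 z] fun _ ↦ c), fderiv_const_apply, zero_apply]

/-- At a point where `χ` is locally constant, its directional derivatives vanish. [folklore] -/
theorem fderiv_apply_eq_zero_of_eventuallyEq {χ : E3 → ℝ} {y : E3} {c : ℝ}
    (h : χ =ᶠ[𝓝 y] fun _ ↦ c) (v : E3) : fderiv ℝ χ y v = 0 :=
  (fderiv_apply_eventuallyEq_zero h v).self_of_nhds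

/-- **Divergence of a field expanded in the coordinate basis**: for `F_j` differentiable at `y`,
`div (Σ_j F_j e_j)(y) = Σ_i ∂_{e_i} F_i (y)`. [folklore] -/
theorem divergence_sum_smul_single {F : Fin 3 → E3 → ℝ} {y : E3}
    (hF : ∀ j, DifferentiableAt ℝ (F j) y) :
    VectorCalculus.divergence
        (fun z ↦ ∑ j : Fin 3, F j z • (EuclideanSpace.single j (1 : ℝ) : E3)) y =
      ∑ i : Fin 3, fderiv ℝ (F i) y (EuclideanSpace.single i (1 : ℝ)) := by
  have hvec : HasFDerivAt (fun z ↦ ∑ j : Fin 3, F j z • (EuclideanSpace.single j (1 : ℝ) : E3))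
      (∑ j : Fin 3, (fderiv ℝ (F j) y).smulRight (EuclideanSpace.single j (1 : ℝ) : E3)) y :=
    HasFDerivAt.fun_sum fun j _ ↦ (hF j).hasFDerivAt.smul_const _
  rw [divergence_eq_sum_inner_fderiv (EuclideanSpace.basisFun (Fin 3) ℝ), hvec.fderiv]
  refine Finset.sum_congr rfl fun i _ ↦ ?_
  rw [EuclideanSpace.basisFun_apply, _root_.sum_apply]
  simp only [ContinuousLinearMap.smulRight_apply]
  exact inner_single_sum_smul_single
    (fun j ↦ fderiv ℝ (F j) y (EuclideanSpace.single i (1 : ℝ) : E3)) i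

/-- **Product rule for the divergence** in the coordinate basis:
`div (φ F)(y) = Σ_i ∂_{e_i}φ(y) F_i(y) + φ(y) div F(y)`. [folklore] -/
theorem divergence_smul_eq {φ : E3 → ℝ} {F : E3 → E3} {y : E3} (hφ : DifferentiableAt ℝ φ y)
    (hF : DifferentiableAt ℝ F y) :
    VectorCalculus.divergence (fun z ↦ φ z • F z) y =
      (∑ i : Fin 3, fderiv ℝ φ y (EuclideanSpace.single i (1 : ℝ)) * F y i) +
        φ y * VectorCalculus.divergence F y := by
  have hd : HasFDerivAt (fun z ↦ φ z • F z) (φ y • fderiv ℝ F y + (fderiv ℝ φ y).smulRight (F y)) y :=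
    hφ.hasFDerivAt.smul hF.hasFDerivAt
  rw [divergence_eq_sum_inner_fderiv (EuclideanSpace.basisFun (Fin 3) ℝ),
    divergence_eq_sum_inner_fderiv (EuclideanSpace.basisFun (Fin 3) ℝ), hd.fderiv, Finset.mul_sum,
    ← Finset.sum_add_distrib]
  refine Finset.sum_congr rfl fun i _ ↦ ?_
  rw [EuclideanSpace.basisFun_apply, _root_.add_apply, _root_.smul_apply,
    ContinuousLinearMap.smulRight_apply, inner_add_right, inner_smul_right, inner_smul_right,
    EuclideanSpace.inner_single_left, EuclideanSpace.inner_single_left]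
  simp only [map_one, one_mul]
  ring

/-- The field vanishing outside a ball has no integral outside it: `∫ f = ∫_{ball} f`. [folklore] -/
theorem integral_eq_setIntegral_ball {f : E3 → ℝ} {ξ : E3} {R : ℝ}
    (h : ∀ y ∉ ball ξ R, f y = 0) : ∫ y, f y = ∫ y in ball ξ R, f y :=
  (setIntegral_eq_integral_of_forall_compl_eq_zero h).symm

/-! ### The cutoff form of the quasi-local momentum -/

/-- **The quasi-local momentum as a bulk pairing with a cutoff gradient.** Let `g` be `C^∞` with
`det g ≠ 0` and `Σ_α ∂_α h^{μ0α} = 0` on an open `W ⊆ E4` containing the slice points `(t, y)`,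
`y ∉ K`; let `χ : E3 → ℝ` be `C^∞`, `= 0` near every point of `K` and `= 1` near every point
outside the open ball `{|y − ξ| < R}`, `R > 0`. Then
`P^μ(t; ξ, R) = ∫ Σ_j ∂_{e_j}χ(y) h^{μ0j}(t, y) dy`. [cite: LandauLifshitz1975, §96 (96.16)] -/
theorem quasiLocalMomentum_eq_integral_cutoff (hW : IsOpen W) (hg : ContDiffOn ℝ ∞ g W)
    (hdet : ∀ x ∈ W, metricDet g x ≠ 0) {μ : Fin 4} (hem : ∀ x ∈ W, emComplex g x μ 0 = 0)
    {t : ℝ} {K : Set E3} (hKW : ∀ y ∉ K, E4.ofTimeSpace t y ∈ W) {χ : E3 → ℝ}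
    (hχ : ContDiff ℝ ∞ χ) (hχ0 : ∀ y ∈ K, χ =ᶠ[𝓝 y] fun _ ↦ 0) {ξ : E3} {R : ℝ} (hR : 0 < R)
    (hχ1 : ∀ y ∉ ball ξ R, χ =ᶠ[𝓝 y] fun _ ↦ 1) :
    quasiLocalMomentum g t ξ R μ =
      ∫ y, ∑ j : Fin 3, fderiv ℝ χ y (EuclideanSpace.single j (1 : ℝ)) *
        hField g (E4.ofTimeSpace t y) μ 0 j.succ := by
  -- the components of the field on the slice, smooth off `K`
  set F : Fin 3 → E3 → ℝ := fun j z ↦ hField g (E4.ofTimeSpace t z) μ 0 j.succ with hF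
  set U : Set E3 := {y : E3 | E4.ofTimeSpace t y ∈ W} with hU
  have hUo : IsOpen U := hW.preimage (E4.continuous_ofTimeSpace t)
  have hKU : ∀ y ∉ K, y ∈ U := fun y hy ↦ hKW y hy
  have hslice : ContDiff ℝ ∞ (E4.ofTimeSpace t) := by
    have h := (contDiff_slice (n := ∞) t (0 : E3))
    simpa only [zero_add] using h
  have hFs : ∀ j, ContDiffOn ℝ ∞ (F j) U := fun j ↦
    (contDiffOn_hField hW hg hdet μ 0 j.succ).comp hslice.contDiffOn fun y hy ↦ hy
  have hFd : ∀ j, ∀ y ∉ K, DifferentiableAt ℝ (F j) y := fun j y hy ↦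
    ((hFs j).contDiffAt (hUo.mem_nhds (hKU y hy))).differentiableAt (by simp)
  set vecF : E3 → E3 :=
    fun z ↦ ∑ j : Fin 3, F j z • (EuclideanSpace.single j (1 : ℝ) : E3) with hvecF
  have hvecFd : ∀ y ∉ K, ContDiffAt ℝ ∞ vecF y := fun y hy ↦
    ContDiffAt.sum fun j _ ↦ ((hFs j).contDiffAt (hUo.mem_nhds (hKU y hy))).smul contDiffAt_const
  -- the global `C¹` stand-in `χ • vecF`
  set V : E3 → E3 := fun z ↦ χ z • vecF z with hV
  have hV0 : ∀ y ∈ K, V =ᶠ[𝓝 y] fun _ ↦ 0 := fun y hy ↦ by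
    filter_upwards [hχ0 y hy] with z hz
    show χ z • vecF z = 0
    rw [hz, zero_smul]
  have hVd : ContDiff ℝ 1 V :=
    contDiff_of_eventuallyEq_zero (fun y hy ↦ (hχ.contDiffAt.smul (hvecFd y hy)).of_le
      (mod_cast le_top)) hV0
  have hχd : Differentiable ℝ χ := hχ.differentiable (by simp)
  -- its divergence is the integrand everywhere
  have hdiv : ∀ y, VectorCalculus.divergence V y =
      ∑ j : Fin 3, fderiv ℝ χ y (EuclideanSpace.single j (1 : ℝ)) * F j y := by
    intro y
    by_cases hy : y ∈ K
    · rw [VectorCalculus.divergence, (hV0 y hy).fderiv_eq, fderiv_const_apply]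
      simp only [ContinuousLinearMap.toLinearMap_zero, map_zero]
      refine (Finset.sum_eq_zero fun j _ ↦ ?_).symm
      rw [fderiv_apply_eq_zero_of_eventuallyEq (hχ0 y hy), zero_mul]
    · have hvdiv : VectorCalculus.divergence vecF y = 0 :=
        (divergence_hFieldVec hW hg hdet μ t (hKU y hy)).trans (hem _ (hKU y hy))
      rw [divergence_smul_eq (hχd y) ((hvecFd y hy).differentiableAt (by simp)), hvdiv, mul_zero,
        add_zero]
      refine Finset.sum_congr rfl fun i _ ↦ ?_
      congr 1
      simp only [hvecF, WithLp.ofLp_sum, WithLp.ofLp_smul, Finset.sum_apply, Pi.smul_apply,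
        PiLp.single_apply, smul_eq_mul, mul_ite, mul_one, mul_zero,
        Finset.sum_ite_eq, Finset.mem_univ, if_true]
  -- the integrand vanishes outside the ball
  have hzero : ∀ y ∉ ball ξ R,
      ∑ j : Fin 3, fderiv ℝ χ y (EuclideanSpace.single j (1 : ℝ)) * F j y = 0 := fun y hy ↦
    Finset.sum_eq_zero fun j _ ↦ by rw [fderiv_apply_eq_zero_of_eventuallyEq (hχ1 y hy), zero_mul]
  -- the flux of the stand-in through the sphere is the quasi-local momentum
  have hflux : ∫ y in sphere ξ R, ⟪R⁻¹ • (y - ξ), V y⟫ ∂(μHE[2] : Measure E3) =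
      quasiLocalMomentum g t ξ R μ := by
    unfold quasiLocalMomentum
    refine setIntegral_congr_fun isClosed_sphere.measurableSet fun y hy ↦ ?_
    have hyb : y ∉ ball ξ R := fun h ↦ by
      rw [mem_sphere] at hy
      rw [mem_ball] at h
      exact h.ne hy
    have h1 : χ y = 1 := (hχ1 y hyb).self_of_nhds
    simp only [hV, hvecF, hF, h1, one_smul]
    rw [inner_sum_smul_single]
    refine Finset.sum_congr rfl fun j _ ↦ ?_
    rw [PiLp.smul_apply, smul_eq_mul]
    ring
  rw [← hflux, ← setIntegral_ball_divergence hVd ξ hR, integral_eq_setIntegral_ball hzero]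
  exact setIntegral_congr_fun measurableSet_ball fun y _ ↦ hdiv y

/-! ### The spatial components of the cutoff current integrate to zero -/

/-- An antisymmetric array contracted with a symmetric one vanishes. [folklore] -/
theorem sum_sum_mul_eq_zero_of_symm_antisymm {A S : Fin 3 → Fin 3 → ℝ}
    (hA : ∀ i m, A i m = -A m i) (hS : ∀ i m, S i m = S m i) :
    ∑ i : Fin 3, ∑ m : Fin 3, A i m * S i m = 0 := by
  have h : ∑ i : Fin 3, ∑ m : Fin 3, A i m * S i m = -∑ i : Fin 3, ∑ m : Fin 3, A i m * S i m := by
    conv_lhs => rw [Finset.sum_comm]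
    rw [← Finset.sum_neg_distrib]
    refine Finset.sum_congr rfl fun i _ ↦ ?_
    rw [← Finset.sum_neg_distrib]
    refine Finset.sum_congr rfl fun m _ ↦ ?_
    rw [hA m i, hS m i]
    ring
  linarith

/-- **The spatial components of the cutoff current integrate to zero.** Let `g` be `C^∞` with
`det g ≠ 0`, `Σ_α ∂_α h^{μ n α} = 0` and `∂_0 h^{μ n 0} = 0` (stationarity) on an open `W ⊆ E4`
containing the slice points `(t, y)`, `y ∉ K`, for the spatial indices `n`; let `χ` be a `C^∞`
cutoff, `= 0` near `K` and `= 1` near every point outside the ball `{|y − ξ| < R}`, `R > 0`. Then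
`∫ Σ_m ∂_{e_m}χ(y) h^{μ n m}(t, y) dy = 0` for every spatial `n`: the integrand is the `n`-th
component of the divergence-free compactly supported field `J^n = Σ_m h^{μnm} ∂_mχ`
(antisymmetry of `h`, LL (96.4)). [cite: LandauLifshitz1975, §96 (96.4)] -/
theorem integral_cutoff_spatial_eq_zero (hW : IsOpen W) (hg : ContDiffOn ℝ ∞ g W)
    (hdet : ∀ x ∈ W, metricDet g x ≠ 0) {μ : Fin 4}
    (hem : ∀ x ∈ W, ∀ m : Fin 3, emComplex g x μ m.succ = 0)
    (hstat : ∀ x ∈ W, ∀ m : Fin 3,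
      LandauLifshitz.partialDeriv 0 (fun z ↦ hField g z μ m.succ 0) x = 0)
    {t : ℝ} {K : Set E3} (hKW : ∀ y ∉ K, E4.ofTimeSpace t y ∈ W) {χ : E3 → ℝ}
    (hχ : ContDiff ℝ ∞ χ) (hχ0 : ∀ y ∈ K, χ =ᶠ[𝓝 y] fun _ ↦ 0) {ξ : E3} {R : ℝ} (hR : 0 < R)
    (hχ1 : ∀ y ∉ ball ξ R, χ =ᶠ[𝓝 y] fun _ ↦ 1) (n : Fin 3) :
    ∫ y, ∑ m : Fin 3, fderiv ℝ χ y (EuclideanSpace.single m (1 : ℝ)) *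
      hField g (E4.ofTimeSpace t y) μ n.succ m.succ = 0 := by
  -- notation: `H n m`, `φ m = ∂_m χ`, the current components `Yc n = Σ_m φ_m H n m`
  set H : Fin 3 → Fin 3 → E3 → ℝ := fun n m z ↦ hField g (E4.ofTimeSpace t z) μ n.succ m.succ
    with hH
  set φ : Fin 3 → E3 → ℝ := fun m z ↦ fderiv ℝ χ z (EuclideanSpace.single m (1 : ℝ)) with hφ
  set U : Set E3 := {y : E3 | E4.ofTimeSpace t y ∈ W} with hU
  have hUo : IsOpen U := hW.preimage (E4.continuous_ofTimeSpace t)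
  have hKU : ∀ y ∉ K, y ∈ U := fun y hy ↦ hKW y hy
  have hslice : ContDiff ℝ ∞ (E4.ofTimeSpace t) := by
    have h := (contDiff_slice (n := ∞) t (0 : E3))
    simpa only [zero_add] using h
  have hHs : ∀ n m, ∀ y ∉ K, ContDiffAt ℝ ∞ (H n m) y := fun n m y hy ↦
    ((contDiffOn_hField hW hg hdet μ n.succ m.succ).comp hslice.contDiffOn fun y hy ↦ hy).contDiffAt
      (hUo.mem_nhds (hKU y hy))
  have hχ' : ContDiff ℝ ∞ (fderiv ℝ χ) := hχ.fderiv_right (by simp)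
  have hφs : ∀ m, ContDiff ℝ ∞ (φ m) := fun m ↦ hχ'.clm_apply contDiff_const
  have hφ0 : ∀ y ∈ K, ∀ᶠ z in 𝓝 y, ∀ m, φ m z = 0 := fun y hy ↦
    eventually_all.2 fun m ↦ fderiv_apply_eventuallyEq_zero (hχ0 y hy) _
  have hφ1 : ∀ y ∉ ball ξ R, ∀ m, φ m y = 0 := fun y hy m ↦
    fderiv_apply_eq_zero_of_eventuallyEq (hχ1 y hy) _
  set Yc : Fin 3 → E3 → ℝ := fun n z ↦ ∑ m : Fin 3, φ m z * H n m z with hYc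
  set Y : E3 → E3 := fun z ↦ ∑ n : Fin 3, Yc n z • (EuclideanSpace.single n (1 : ℝ) : E3) with hY
  have hYcs : ∀ n, ∀ y ∉ K, ContDiffAt ℝ ∞ (Yc n) y := fun n y hy ↦
    ContDiffAt.sum fun m _ ↦ (hφs m).contDiffAt.mul (hHs n m y hy)
  have hYc0 : ∀ y ∈ K, ∀ᶠ z in 𝓝 y, ∀ n, Yc n z = 0 := fun y hy ↦ by
    filter_upwards [hφ0 y hy] with z hz
    intro n
    exact Finset.sum_eq_zero fun m _ ↦ by rw [hz m, zero_mul]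
  have hYc1 : ∀ y ∉ ball ξ R, ∀ n, Yc n y = 0 := fun y hy n ↦
    Finset.sum_eq_zero fun m _ ↦ by rw [hφ1 y hy m, zero_mul]
  have hY0 : ∀ y ∈ K, Y =ᶠ[𝓝 y] fun _ ↦ 0 := fun y hy ↦ by
    filter_upwards [hYc0 y hy] with z hz
    exact Finset.sum_eq_zero fun n _ ↦ by rw [hz n, zero_smul]
  have hY1 : ∀ y ∉ ball ξ R, Y y = 0 := fun y hy ↦
    Finset.sum_eq_zero fun n _ ↦ by rw [hYc1 y hy n, zero_smul]
  have hYd : ContDiff ℝ 1 Y :=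
    contDiff_of_eventuallyEq_zero (fun y hy ↦ (ContDiffAt.sum fun n _ ↦
      (hYcs n y hy).smul contDiffAt_const).of_le (mod_cast le_top)) hY0
  -- the current is divergence-free
  have hdivY : ∀ y, VectorCalculus.divergence Y y = 0 := by
    intro y
    by_cases hy : y ∈ K
    · rw [VectorCalculus.divergence, (hY0 y hy).fderiv_eq, fderiv_const_apply]
      simp only [ContinuousLinearMap.toLinearMap_zero, map_zero]
    rw [divergence_sum_smul_single fun j ↦ (hYcs j y hy).differentiableAt (by simp)]
    -- expand `∂_i Yc i`
    have hder : ∀ i, fderiv ℝ (Yc i) y (EuclideanSpace.single i (1 : ℝ)) =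
        ∑ m : Fin 3, (φ m y * fderiv ℝ (H i m) y (EuclideanSpace.single i (1 : ℝ)) +
          H i m y * fderiv ℝ (fderiv ℝ χ) y (EuclideanSpace.single i (1 : ℝ))
            (EuclideanSpace.single m (1 : ℝ))) := by
      intro i
      have hφd : ∀ m, HasFDerivAt (φ m)
          ((fderiv ℝ (fderiv ℝ χ) y).flip (EuclideanSpace.single m (1 : ℝ))) y := by
        intro m
        have h := ((hχ'.differentiable (by simp)) y).hasFDerivAt.clm_apply
          (hasFDerivAt_const (EuclideanSpace.single m (1 : ℝ) : E3) y)
        simp only [ContinuousLinearMap.comp_zero, zero_add] at h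
        exact h
      have h := HasFDerivAt.fun_sum (u := Finset.univ) fun m _ ↦
        (hφd m).fun_mul ((hHs i m y hy).differentiableAt (by simp)).hasFDerivAt
      rw [show fderiv ℝ (Yc i) y = _ from h.fderiv]
      simp only [FunLike.coe_sum, Finset.sum_apply, _root_.add_apply,
        FunLike.coe_smul, Pi.smul_apply, smul_eq_mul, ContinuousLinearMap.flip_apply]
    simp only [hder, Finset.sum_add_distrib]
    -- the Hessian term vanishes by antisymmetry of `h` and symmetry of second derivatives
    have hsymm := hχ.contDiffAt.isSymmSndFDerivAt (n := ∞) (x := y)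
      (by rw [minSmoothness_of_isRCLikeNormedField]; exact WithTop.coe_le_coe.2 le_top)
    have hB : ∑ i : Fin 3, ∑ m : Fin 3, H i m y * fderiv ℝ (fderiv ℝ χ) y
        (EuclideanSpace.single i (1 : ℝ)) (EuclideanSpace.single m (1 : ℝ)) = 0 :=
      sum_sum_mul_eq_zero_of_symm_antisymm (fun i m ↦ hField_swap g _ μ m.succ i.succ)
        fun i m ↦ hsymm _ _
    -- the other term is `Σ_m φ_m Σ_i ∂_{i+1} h^{μ (i+1) (m+1)} = -Σ_m φ_m Σ_i ∂_{i+1} h^{μ (m+1)(i+1)} = 0`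
    have hx : E4.ofTimeSpace t y ∈ W := hKU y hy
    have hHd : ∀ ν α, DifferentiableAt ℝ (fun x ↦ hField g x μ ν α) (E4.ofTimeSpace t y) :=
      fun ν α ↦ ((contDiffOn_hField hW hg hdet μ ν α).contDiffAt (hW.mem_nhds hx)).differentiableAt
        (by simp)
    have hA : ∀ m : Fin 3, ∑ i : Fin 3, fderiv ℝ (H i m) y (EuclideanSpace.single i (1 : ℝ)) = 0 := by
      intro m
      have h1 : ∀ i : Fin 3, fderiv ℝ (H i m) y (EuclideanSpace.single i (1 : ℝ)) =
          -LandauLifshitz.partialDeriv i.succ (fun x ↦ hField g x μ m.succ i.succ)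
            (E4.ofTimeSpace t y) := by
        intro i
        rw [show H i m = fun z ↦ (fun x ↦ hField g x μ i.succ m.succ) (E4.ofTimeSpace t z) from rfl,
          fderiv_comp_ofTimeSpace_single (hHd _ _) i, LandauLifshitz.partialDeriv,
          LandauLifshitz.partialDeriv,
          show (fun x ↦ hField g x μ i.succ m.succ) = fun x ↦ -hField g x μ m.succ i.succ from
            funext fun x ↦ hField_swap g x μ m.succ i.succ, fderiv_fun_neg, _root_.neg_apply]
      have h2 : emComplex g (E4.ofTimeSpace t y) μ m.succ = 0 := hem _ hx m
      rw [emComplex, Fin.sum_univ_succ, hstat _ hx m, zero_add] at h2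
      simp only [h1, Finset.sum_neg_distrib, h2, neg_zero]
    rw [hB, add_zero, Finset.sum_comm]
    refine Finset.sum_eq_zero fun m _ ↦ ?_
    rw [← Finset.mul_sum, hA m, mul_zero]
  -- `Yc n = div (y_n • Y)` integrates to zero over a ball containing the support
  set pr : E3 →L[ℝ] ℝ := EuclideanSpace.proj (𝕜 := ℝ) n with hpr
  set G : E3 → E3 := fun z ↦ pr z • Y z with hG
  have hGd : ContDiff ℝ 1 G := pr.contDiff.smul hYd
  have hdivG : ∀ y, VectorCalculus.divergence G y = Yc n y := by
    intro y
    rw [divergence_smul_eq pr.differentiableAt (hYd.differentiable one_ne_zero y), hdivY y,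
      mul_zero, add_zero, pr.fderiv]
    simp only [hpr, PiLp.proj_apply, hY, WithLp.ofLp_sum, WithLp.ofLp_smul, Finset.sum_apply,
      Pi.smul_apply, PiLp.single_apply, smul_eq_mul, mul_ite, mul_one, mul_zero,
      Finset.sum_ite_eq, Finset.mem_univ, if_true]
    simp only [ite_mul, one_mul, zero_mul, Finset.sum_ite_eq, Finset.mem_univ, if_true]
  have hR1 : 0 < R + 1 := by linarith
  have hzero : ∀ y ∉ ball ξ (R + 1), Yc n y = 0 := fun y hy ↦
    hYc1 y (fun h ↦ hy (ball_subset_ball (by linarith) h)) n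
  rw [integral_eq_setIntegral_ball hzero,
    ← setIntegral_congr_fun measurableSet_ball fun y _ ↦ hdivG y,
    setIntegral_ball_divergence hGd ξ hR1]
  refine setIntegral_eq_zero_of_forall_eq_zero fun y hy ↦ ?_
  have hyb : y ∉ ball ξ R := fun h ↦ by
    rw [mem_sphere] at hy
    rw [mem_ball] at h
    linarith
  rw [hG]
  simp only [hY1 y hyb, smul_zero, inner_zero_right]

end SublinearIsFree.ChargeModel

/-- Registered sub-goal form (stub `ll_cutoffCurrent_spatial_integral_eq_zero` of the crux item) of
`SublinearIsFree.ChargeModel.integral_cutoff_spatial_eq_zero`: the spatial components of the cutoff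
current of a stationary vacuum field integrate to zero. [cite: LandauLifshitz1975, §96 (96.4)] -/
theorem ll_cutoffCurrent_spatial_integral_eq_zero : open Literature.Geometry.Lorentzian Metric in ∀ (g : E4 → E4 →L[ℝ] E4 →L[ℝ] ℝ) (W : Set E4), IsOpen W → ContDiffOn ℝ ((⊤ : ℕ∞) : WithTop ℕ∞) g W → (∀ x ∈ W, LandauLifshitz.metricDet g x ≠ 0) → ∀ (μ : Fin 4), (∀ x ∈ W, ∀ m : Fin 3, LandauLifshitz.emComplex g x μ m.succ = 0) → (∀ x ∈ W, ∀ m : Fin 3, LandauLifshitz.partialDeriv 0 (fun z ↦ LandauLifshitz.hField g z μ m.succ 0) x = 0) → ∀ (t : ℝ) (K : Set E3), (∀ y ∉ K, E4.ofTimeSpace t y ∈ W) → ∀ (χ : E3 → ℝ), ContDiff ℝ ((⊤ : ℕ∞) : WithTop ℕ∞) χ → (∀ y ∈ K, χ =ᶠ[nhds y] fun _ ↦ 0) → ∀ (ξ : E3) (R : ℝ), 0 < R → (∀ y ∉ ball ξ R, χ =ᶠ[nhds y] fun _ ↦ 1) → ∀ n : Fin 3, ∫ y, ∑ m : Fin 3,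 fderiv ℝ χ y (EuclideanSpace.single m (1 : ℝ)) * LandauLifshitz.hField g (E4.ofTimeSpace t y) μ n.succ m.succ = 0 :=
  fun _g _W hW hg hdet _μ hem hstat _t _K hKW _χ hχ hχ0 _ξ _R hR hχ1 n ↦
    SublinearIsFree.ChargeModel.integral_cutoff_spatial_eq_zero hW hg hdet hem hstat hKW hχ hχ0 hR
      hχ1 n

end Summit.FinalStateConjecture.FinalStateConjecture.Theorems

end
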